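import Literature.NumberTheory.Automorphic.TorusUnitBoxUnfolding
import Literature.NumberTheory.GaloisRepresentations.UnitIdeles
import Mathlib.MeasureTheory.Integral.Pi
import Mathlib.MeasureTheory.Integral.ExpDecay
import Mathlib.Analysis.SpecialFunctions.ImproperIntegrals
import HarnessLib

/-!
# Peeling off a bad place of a torus integral (with an offset), and the archimedean exponential
# integrals of torus majorants
(Jacquet–Shalika (1981), §4; Cogdell (2004), §2.3: absolute convergence of unfolded integrals)

Topic `NumberTheory/Automorphic`; namespace `Literature.NumberTheory.Automorphic`. Proof file
(theorems only), sequel to `TorusUnitBoxUnfolding`. Two further reductions used in bounding torus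
integrals of factorizable majorants:

* `setLIntegral_unitBox_comp_mul_eq` — `∫_{B(G)} f(T₀ a) dν(a) = ∫_{B(G)} f dν` for `T₀` a unit at the
  places of `G` (left invariance; `T₀ B(G) = B(G)`);
* `setLIntegral_unitBox_eq_tsum_mul_of_offset` (**bad places**) — at a place `v ∉ G` where the
  integrand is supported on `{|a_i|_v ≤ q_v^{c}}` rather than on the `v`-integral points, translating by
  `T₀ = ϖ_v^{c·𝟙}` reduces to `setLIntegral_unitBox_eq_tsum_mul`:
  `∫_{B(G)} f = (Σ_μ c_μ) κ ∫_{B(insert v G)} f` when `f ∘ (T₀⁻¹ ·)` scales by `c_μ`, vanishes off the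
  `v`-integral points and equals `κ f` at the points that are units at `v`;
* `lintegral_ofReal_prod_lt_top` — `∫ ofReal (∏_p g_p(u_p)) du < ∞` on `ℝ^ι` for integrable
  `g_p ≥ 0` (Fubini, `Integrable.fintype_prod`);
* `integrable_exp_neg_mul_abs`, `integrable_min_one_exp_neg_mul_exp_mul` — `x ↦ min(1, e^{-αx}) e^{βx}`
  is integrable on `ℝ` for
  `0 < β < α` (the archimedean factors of the majorants: decay `e^{-αx}` of Whittaker functions against
  the torus weight `e^{βx}`).

## References

* H. Jacquet, J. A. Shalika, Amer. J. Math. 103 (1981), §4 [JacquetShalikaAJM1981].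
* J. W. Cogdell, *Analytic theory of L-functions for GL_n* (2004), §2.3 [CogdellAnalyticTheory2004].
-/

noncomputable section

open MeasureTheory Measure NumberField IsDedekindDomain Set Filter Topology
open Literature.NumberTheory.GaloisRepresentations (ideleGroup localUnits)
open scoped ENNReal NNReal Pointwise

namespace Literature.NumberTheory.Automorphic

/-! ### Translating the unit box by a unit -/

section Offset

variable {n : ℕ} {K : Type} [Field K] [NumberField K]
variable [MeasurableSpace (ideleGroup K)] [BorelSpace (ideleGroup K)]

attribute [local instance] secondCountableTopology_ideleGroup

variable (νA : Measure (Fin n → ideleGroup K)) [νA.IsMulLeftInvariant]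

omit [MeasurableSpace (ideleGroup K)] [BorelSpace (ideleGroup K)] in
/-- The unit box at `G` is stable under multiplication by an element which is a unit at the places
of `G`. [folklore] -/
theorem smul_unitBox_eq_of_forall_valued_eq_one {G : Set (HeightOneSpectrum (𝓞 K))}
    {T₀ : Fin n → ideleGroup K}
    (hT₀ : ∀ w ∈ G, ∀ i, Valued.v (((T₀ i : ideleGroup K) : AdeleRing (𝓞 K) K).2 w) = 1) :
    T₀ • unitBox (n := n) (K := K) G = unitBox G := by
  have hmul : ∀ a : Fin n → ideleGroup K, a ∈ unitBox (n := n) (K := K) G → T₀ * a ∈ unitBox (n := n) (K := K) G := by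
    intro a ha w hw i
    rw [Pi.mul_apply, GaloisRepresentations.ideleGroup_val_snd_mul, map_mul, hT₀ w hw i, ha w hw i, one_mul]
  have hinv : ∀ w ∈ G, ∀ i, Valued.v ((((T₀⁻¹ : Fin n → ideleGroup K) i : ideleGroup K) : AdeleRing (𝓞 K) K).2 w) = 1 := by
    intro w hw i
    rw [Pi.inv_apply, GaloisRepresentations.ideleGroup_val_inv_snd, map_inv₀, hT₀ w hw i, inv_one]
  have hmul' : ∀ a : Fin n → ideleGroup K, a ∈ unitBox (n := n) (K := K) G → T₀⁻¹ * a ∈ unitBox (n := n) (K := K) G := by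
    intro a ha w hw i
    rw [Pi.mul_apply, GaloisRepresentations.ideleGroup_val_snd_mul, map_mul, hinv w hw i, ha w hw i, one_mul]
  ext b
  constructor
  · rintro ⟨a, ha, rfl⟩
    exact hmul a ha
  · intro hb
    refine ⟨T₀⁻¹ * b, hmul' b hb, ?_⟩
    change T₀ * (T₀⁻¹ * b) = b
    rw [mul_inv_cancel_left]

/-- **`∫_{B(G)} f(T₀ a) dν(a) = ∫_{B(G)} f dν`** for `T₀` a unit at the places of `G`. [folklore] -/
theorem setLIntegral_unitBox_comp_mul_eq {G : Set (HeightOneSpectrum (𝓞 K))}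
    {T₀ : Fin n → ideleGroup K}
    (hT₀ : ∀ w ∈ G, ∀ i, Valued.v (((T₀ i : ideleGroup K) : AdeleRing (𝓞 K) K).2 w) = 1)
    (f : (Fin n → ideleGroup K) → ℝ≥0∞) :
    ∫⁻ a in unitBox G, f (T₀ * a) ∂νA = ∫⁻ a in unitBox G, f a ∂νA := by
  rw [← setLIntegral_smul_torus_eq νA T₀ (unitBox G) f, smul_unitBox_eq_of_forall_valued_eq_one hT₀]

variable {v : HeightOneSpectrum (𝓞 K)} {ϖ : (v.adicCompletion K)ˣ}

omit [MeasurableSpace (ideleGroup K)] [BorelSpace (ideleGroup K)] in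
/-- `ϖ_v^μ` is a unit away from `v`. [folklore] -/
theorem valued_localTorusPow_snd_of_ne (mu : Fin n → ℕ) {w : HeightOneSpectrum (𝓞 K)} (hw : w ≠ v)
    (i : Fin n) : Valued.v (((localTorusPow ϖ mu i : ideleGroup K) : AdeleRing (𝓞 K) K).2 w) = 1 := by
  rw [localTorusPow_snd_apply_of_ne ϖ mu i hw, map_one]

/-- **Peeling off a bad place.** Let `v ∉ G`, `ϖ` a uniformizer at `v`, `c : ℕ` and `T₀ = ϖ_v^{c·𝟙}`.
If the measurable `f ≥ 0` is such that `g = f(T₀⁻¹ ·)` scales by `c_μ` under `ϖ_v^μ` at the points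
which are units at `v`, vanishes at the points having an entry of `v`-valuation `> 1`, and equals
`κ f` at the points which are units at `v`, then
`∫_{B(G)} f dν = (Σ_μ c_μ) κ ∫_{B(insert v G)} f dν`. [folklore] -/
theorem setLIntegral_unitBox_eq_tsum_mul_of_offset
    (hϖ : Valued.v (ϖ : v.adicCompletion K) = WithZero.exp (-1 : ℤ))
    {G : Set (HeightOneSpectrum (𝓞 K))} (hv : v ∉ G) (c : ℕ)
    {f : (Fin n → ideleGroup K) → ℝ≥0∞} (hf : Measurable f) (cmu : (Fin n → ℕ) → ℝ≥0∞) (κ : ℝ≥0∞)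
    (hscale : ∀ (mu : Fin n → ℕ) (b : Fin n → ideleGroup K),
      (∀ i, Valued.v (((b i : ideleGroup K) : AdeleRing (𝓞 K) K).2 v) = 1) →
      f ((localTorusPow ϖ fun _ => c)⁻¹ * (localTorusPow ϖ mu * b)) =
        cmu mu * f ((localTorusPow ϖ fun _ => c)⁻¹ * b))
    (hsupp : ∀ b : Fin n → ideleGroup K,
      (∃ i, 1 < Valued.v (((b i : ideleGroup K) : AdeleRing (𝓞 K) K).2 v)) →
      f ((localTorusPow ϖ fun _ => c)⁻¹ * b) = 0)
    (hunit : ∀ b : Fin n → ideleGroup K,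
      (∀ i, Valued.v (((b i : ideleGroup K) : AdeleRing (𝓞 K) K).2 v) = 1) →
      f ((localTorusPow ϖ fun _ => c)⁻¹ * b) = κ * f b) :
    ∫⁻ a in unitBox G, f a ∂νA = (∑' mu : Fin n → ℕ, cmu mu) * κ * ∫⁻ b in unitBox (insert v G), f b ∂νA := by
  set T₀ : Fin n → ideleGroup K := localTorusPow ϖ fun _ => c with hT₀
  have hT₀inv : ∀ w ∈ G, ∀ i, Valued.v ((((T₀⁻¹ : Fin n → ideleGroup K) i : ideleGroup K) : AdeleRing (𝓞 K) K).2 w) = 1 := by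
    intro w hw i
    have hwv : w ≠ v := fun h => hv (h ▸ hw)
    rw [Pi.inv_apply, GaloisRepresentations.ideleGroup_val_inv_snd, map_inv₀, valued_localTorusPow_snd_of_ne _ hwv, inv_one]
  -- `∫ f = ∫ g`, `g = f (T₀⁻¹ ·)`
  rw [← setLIntegral_unitBox_comp_mul_eq νA hT₀inv f]
  have hgm : Measurable fun a => f (T₀⁻¹ * a) := hf.comp (measurable_const_mul _)
  rw [setLIntegral_unitBox_eq_tsum_mul νA hϖ hv hgm cmu (fun mu b hb => hscale mu b fun i => hb v (Set.mem_insert v G) i)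
    (fun b _ hb => hsupp b hb)]
  rw [mul_assoc]
  congr 1
  rw [← lintegral_const_mul κ hf]
  exact setLIntegral_congr_fun (measurableSet_unitBox _) fun b hb => hunit b fun i => hb v (Set.mem_insert v G) i

end Offset

/-! ### The archimedean exponential integrals -/

section Arch

/-- **`∫ ofReal (∏_p g_p(u_p)) du < ∞`** on `ℝ^ι` for integrable `g_p ≥ 0` (Fubini). [folklore] -/
theorem lintegral_ofReal_prod_lt_top {ι : Type*} [Fintype ι] (g : ι → ℝ → ℝ)
    (hg : ∀ p, Integrable (g p)) (hg0 : ∀ p x, 0 ≤ g p x) :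
    ∫⁻ u : ι → ℝ, ENNReal.ofReal (∏ p, g p (u p)) < ∞ := by
  have hint : Integrable (fun u : ι → ℝ => ∏ p, g p (u p)) := Integrable.fintype_prod hg
  rw [← ofReal_integral_eq_lintegral_ofReal hint (Eventually.of_forall fun u =>
    Finset.prod_nonneg fun p _ => hg0 p (u p))]
  exact ENNReal.ofReal_lt_top

/-- `min(1, e^{-αx}) e^{βx} ≤ e^{-γ|x|}` with `γ = min(β, α - β)`. [folklore] -/
theorem min_one_exp_neg_mul_exp_le {α β x : ℝ} :
    min 1 (Real.exp (-α * x)) * Real.exp (β * x) ≤ Real.exp (-(min β (α - β)) * |x|) := by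
  rcases le_or_gt 0 x with hx | hx
  · rw [abs_of_nonneg hx]
    calc min 1 (Real.exp (-α * x)) * Real.exp (β * x) ≤ Real.exp (-α * x) * Real.exp (β * x) :=
          mul_le_mul_of_nonneg_right (min_le_right _ _) (Real.exp_pos _).le
      _ = Real.exp ((β - α) * x) := by rw [← Real.exp_add]; ring_nf
      _ ≤ Real.exp (-(min β (α - β)) * x) := by
          refine Real.exp_le_exp.2 (mul_le_mul_of_nonneg_right ?_ hx)
          linarith [min_le_right β (α - β)]
  · rw [abs_of_neg hx]
    calc min 1 (Real.exp (-α * x)) * Real.exp (β * x) ≤ 1 * Real.exp (β * x) :=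
          mul_le_mul_of_nonneg_right (min_le_left _ _) (Real.exp_pos _).le
      _ = Real.exp (β * x) := one_mul _
      _ ≤ Real.exp (-(min β (α - β)) * -x) := by
          refine Real.exp_le_exp.2 ?_
          have h := min_le_left β (α - β)
          nlinarith

/-- `x ↦ e^{-γ|x|}` is integrable on `ℝ` for `0 < γ`. [folklore] -/
theorem integrable_exp_neg_mul_abs {γ : ℝ} (hγ : 0 < γ) :
    Integrable fun x : ℝ => Real.exp (-γ * |x|) := by
  have h1 : IntegrableOn (fun x : ℝ => Real.exp (-γ * |x|)) (Set.Iic 0) := by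
    refine (integrableOn_exp_mul_Iic hγ 0).congr_fun (fun x hx => ?_) measurableSet_Iic
    rw [abs_of_nonpos (Set.mem_Iic.1 hx)]; ring_nf
  have h2 : IntegrableOn (fun x : ℝ => Real.exp (-γ * |x|)) (Set.Ioi 0) := by
    refine (exp_neg_integrableOn_Ioi 0 hγ).congr_fun (fun x hx => ?_) measurableSet_Ioi
    rw [abs_of_pos (Set.mem_Ioi.1 hx)]
  have h := h1.union h2
  rwa [Set.Iic_union_Ioi, integrableOn_univ] at h

/-- **`x ↦ min(1, e^{-αx}) e^{βx}` is integrable on `ℝ`** for `0 < β < α`. [folklore] -/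
theorem integrable_min_one_exp_neg_mul_exp_mul {α β : ℝ} (hβ : 0 < β) (hβα : β < α) :
    Integrable fun x : ℝ => min 1 (Real.exp (-α * x)) * Real.exp (β * x) := by
  have hγ : 0 < min β (α - β) := lt_min hβ (by linarith)
  have hdom : Integrable fun x : ℝ => Real.exp (-(min β (α - β)) * |x|) := integrable_exp_neg_mul_abs hγ
  refine hdom.mono ?_ (Eventually.of_forall fun x => ?_)
  · exact ((measurable_const.min (Real.continuous_exp.measurable.comp (measurable_const.mul measurable_id))).mul
      (Real.continuous_exp.measurable.comp (measurable_const.mul measurable_id))).aestronglyMeasurable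
  · rw [Real.norm_of_nonneg (mul_nonneg (le_min zero_le_one (Real.exp_pos _).le) (Real.exp_pos _).le),
      Real.norm_of_nonneg (Real.exp_pos _).le]
    exact min_one_exp_neg_mul_exp_le

end Arch

end Literature.NumberTheory.Automorphic
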